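import Mathlib
import Literature.Barriers.MatrixMultiplication.NilpotentGroupBarrierGradedCoords
import Summits.MatrixMultiplication.MatrixMultiplication.Theorems.SnSubsetDichotomyNoThresholdSubsetTripleStubCodim

/-!
# `SnSubsetDichotomy.NoThresholdSubsetTriple`, line `klr-graded-polynomial-method`: `stub_gradedCodim`

Blasiak–Church–Cohn–Grochow–Umans 2017 (arXiv:1712.02302), Prop. 3.2, in coordinates, for a
`ℤ`-GRADED BLOCK BASIS of a group algebra, in the form registered by the skeleton of crux
`stmt-MatrixMultiplication-8302` (`Cruxes/NoThresholdSubsetTriple`, line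
`klr-graded-polynomial-method`, stub `stub_gradedCodim`): if `β` is a basis of
`K[G] = MonoidAlgebra K G` indexed by a finite type `Λ`, with degrees `deg : Λ → ℤ` and block
labels `blk : Λ → Blk`, such that every product `β_i · β_j` lies in the span of the `β_k` with
`blk k = blk i = blk j` and `deg k = deg i + deg j`, then for every block-dependent cut
`a : Blk → ℤ`,

`slice-rank D_G ≤ 2 · #{i : deg i < a (blk i)} + #{k : 2 · a (blk k) ≤ deg k}`,

where `D_G(x,y,z) = [xyz = 1] = mulGroupTensor K G`.

Proof: the tree's three-basis graded bound `hasSliceRankLE_mulGroupTensor_of_bases`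
(`Theorems/SnSubsetDichotomyNoThresholdSubsetTripleStubCodim.lean`) with `bX = bY = bZ = β`, the
indicator degrees `dx = dy = 𝟙[a (blk ·) ≤ deg ·] ∈ {0,1}`, `dz = 1 + 𝟙[2 a (blk ·) ≤ deg ·] ∈ {1,2}`
and thresholds `(1,1)`.  The grading `[β_k](β_i β_j) ≠ 0 → dx i + dx j ≤ dz k` holds because the
coordinates of an element of `span (β '' S)` are supported on `S` (`Module.Basis.mem_span_image`),
so a nonzero coordinate forces `blk k = blk i = blk j` and `deg k = deg i + deg j`; if
`dx i = dx j = 1` then `deg k ≥ a (blk i) + a (blk j) = 2 a (blk k)`, i.e. `dz k = 2`.  Negative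
degrees need no shift: only `V_{≥a} · V_{≥a} ⊆ V_{≥2a}` blockwise is used.  Finally
`#{dx < 1} = #{deg < a ∘ blk}` and `#{2 ≤ dz} = #{2 a ∘ blk ≤ deg}`.
-/

namespace Summit.MatrixMultiplication.MatrixMultiplication.Theorems

open Literature.Barriers.MatrixMultiplication Literature.Combinatorics.Additive

set_option linter.dupNamespace false in -- deliberate `Summit.<S>.<P>` duplicate
/-- **Stub `stub_gradedCodim` of line `klr-graded-polynomial-method` (crux
`SnSubsetDichotomy.NoThresholdSubsetTriple`, stmt-MatrixMultiplication-8302) — BCCGU 2017,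
Prop. 3.2 for `ℤ`-graded block bases.**  If `β` is a basis of `K[G]` indexed by the finite type
`Λ`, `deg : Λ → ℤ`, `blk : Λ → Blk`, and every product `β_i β_j` lies in
`span{β_k : blk k = blk i = blk j, deg k = deg i + deg j}`, then for every block-dependent cut
`a : Blk → ℤ`, `slice-rank_K D_G ≤ 2·#{i : deg i < a(blk i)} + #{k : 2·a(blk k) ≤ deg k}`
(`D_G(x,y,z) = [xyz = 1]`, the tree's `mulGroupTensor`).  Proof: the three-basis graded bound
`hasSliceRankLE_mulGroupTensor_of_bases` with `bX = bY = bZ = β`, indicator degrees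
`dx = dy = 𝟙[a(blk ·) ≤ deg ·]`, `dz = 1 + 𝟙[2a(blk ·) ≤ deg ·]` and thresholds `(1,1)`; the
grading is read off from the supports of the coordinates (`Module.Basis.mem_span_image`).  Stated in
the registered `∀`-form (= the body of the skeleton's `GradedCodimBound`); use it as
`stub_gradedCodim K G Λ Blk β deg blk hβ a`. [folklore] -/
theorem stub_gradedCodim : ∀ (K : Type) [Field K] (G : Type) [Group G] [Fintype G] [DecidableEq G]
    (Λ : Type) [Finite Λ] (Blk : Type) (β : Module.Basis Λ K (MonoidAlgebra K G)) (deg : Λ → ℤ)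
    (blk : Λ → Blk), (∀ i j : Λ, β i * β j ∈ Submodule.span K
      (β '' {k | blk k = blk i ∧ blk k = blk j ∧ deg k = deg i + deg j})) →
    ∀ a : Blk → ℤ, Literature.Barriers.MatrixMultiplication.sliceRank
        (Literature.Barriers.MatrixMultiplication.mulGroupTensor K G) ≤
      2 * Nat.card {i : Λ // deg i < a (blk i)} + Nat.card {k : Λ // 2 * a (blk k) ≤ deg k} := by
  intro K _ G _ _ _ Λ _ Blk β deg blk hβ a
  classical
  haveI := Fintype.ofFinite Λ
  -- indicator degrees (`x`- and `y`-leg share `dx`)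
  let dx : Λ → ℕ := fun i => if a (blk i) ≤ deg i then 1 else 0
  let dz : Λ → ℕ := fun k => if 2 * a (blk k) ≤ deg k then 2 else 1
  -- the grading, read off from the supports of the structure constants
  have hgr : ∀ i j k, β.repr (β i * β j) k ≠ 0 → dx i + dx j ≤ dz k := by
    intro i j k hne
    obtain ⟨hki, hkj, hdeg⟩ : blk k = blk i ∧ blk k = blk j ∧ deg k = deg i + deg j :=
      β.repr_support_subset_of_mem_span _ (hβ i j) (Finsupp.mem_support_iff.2 hne)
    have hai : a (blk i) = a (blk k) := by rw [hki]
    have haj : a (blk j) = a (blk k) := by rw [hkj]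
    simp only [dx, dz]
    split_ifs <;> omega
  have hSR := (hasSliceRankLE_mulGroupTensor_of_bases β β β dx dx dz hgr 1 1).sliceRank_le
  -- the two counts
  have c1 : Fintype.card {i // dx i < 1} = Nat.card {i : Λ // deg i < a (blk i)} := by
    rw [Nat.card_eq_fintype_card]
    exact Fintype.card_congr (Equiv.subtypeEquivRight fun i => by
      simp only [dx]
      split_ifs with h <;> omega)
  have c3 : Fintype.card {k // 1 + 1 ≤ dz k} = Nat.card {k : Λ // 2 * a (blk k) ≤ deg k} := by
    rw [Nat.card_eq_fintype_card]
    exact Fintype.card_congr (Equiv.subtypeEquivRight fun k => by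
      simp only [dz]
      split_ifs with h <;> omega)
  omega

end Summit.MatrixMultiplication.MatrixMultiplication.Theorems
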